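import Literature.AlgebraicGeometry.Frobenioids.Monoids
import Literature.AlgebraicGeometry.Frobenioids.MonoidFunctors
import Literature.AnabelianGeometry.EtaleTheta.Conventions

/-!
# [EtTh] Lemma 3.5, the "`P^pf`" portion: perfections of submonoids of a perfect monoid — proofs

Source: S. Mochizuki, *The étale theta function and its Frobenioid-theoretic manifestations*,
Publ. RIMS **45** (2009) [MochizukiEtTh2009], Lemma 3.5, PDF p. 75 (printed 301); locators `p.N` =
PDF page of the PRIMS text (cell convention for this key).

Lemma 3.5 ("Perfections and Realifications of Perf-factorial Submonoids"): for perf-factorial monoids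
`P ⊆ Q` with `P` group-saturated in `Q` (§0) and `ℝ` supporting `Q` ([FrdI] Def. 2.4 (ii): in
particular `Q` is perfect), (i) "the inclusion `P ↪ Q` extends uniquely to inclusions `P^pf ↪ Q`,
`P^rlf ↪ Q`"; (ii) "relative to the inclusions of (i), `P^pf`, `P^rlf` are group-saturated in `Q`".
The printed proof (p. 75): "the portion of assertions (i), (ii) involving '`P^pf`' follows immediately
from the definitions". This file PROVES that portion, stub-free, over the tree's `Perfection`
(`Frobenioids/Monoids.lean`) and the §0 notions `perfSaturation`, `IsGroupSaturated`
(`EtaleTheta/Conventions.lean`), with the hypotheses the argument actually uses: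

* `Lemma35.exists_extension`, `Lemma35.extension_unique`, `Lemma35.existsUnique_extension`: for `Q`
  perfect and ANY submonoid `P ⊆ Q`, the inclusion extends uniquely to `P^pf → Q` (existence and
  uniqueness use only that `Q` is perfect);
* `Lemma35.extension_injective`: every such extension is injective (this needs NO hypothesis — the
  "crucial hypothesis" of Remark 3.5.2, p. 76, concerns the realification `P^rlf`, whose injectivity
  does fail without group-saturation, cf. `Remark352` in the §3 statement file of seat abc-iut-L2-t3);
* `Lemma35.mrange_extension_eq_perfSaturation`: the image of `P^pf` in `Q` is the perf-saturation
  `P^pf ∩ Q` of §0;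
* `Lemma35.isGroupSaturated_perfSaturation`, `Lemma35.isGroupSaturated_mrange_extension`: (ii) for
  `P^pf` — if `P` is group-saturated in `Q` then so is (the image of) `P^pf`.

NOT here: the `P^rlf` portion (realification, [FrdI] Def. 2.4 (i); the printed argument pp. 75–76 via
primary components and [FrdI] Def. 2.4 (i)(d) is not "light"), Remark 3.5.1, and the perf-factoriality
hypotheses (not used by the `P^pf` portion). The §3 statement file (`DivisorMonoids.lean`, seat
abc-iut-L2-t3) records Lemma 3.5 as named `Prop`s over a [FrdI]-vocabulary hypothesis structure; the
theorems below are the vocabulary-free content its `P^pf` conjuncts reduce to once "`ℝ` supports `Q`"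
is known to give `IsPerfect Q`. Proof-only companion (no definitions); seat abc-iut-L6-t12 (W2-L2-09).
-/

namespace Literature.AnabelianGeometry.EtaleTheta

open Literature.AlgebraicGeometry.Frobenioids

universe u

namespace Lemma35

variable {Q : Type u} [CommMonoid Q]

/-- §0 bookkeeping behind Lemma 3.5 (ii): if `P` is group-saturated in `Q`, then so is its
perf-saturation `P^pf ∩ Q` (if `q · b = a` with `a^n, b^m ∈ P`, then `q^{nm} · b^{nm} = a^{nm}` with
both factors in `P`, so `q^{nm} ∈ P`). [cite: MochizukiEtTh2009, Lem 3.5 p.75] -/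
theorem isGroupSaturated_perfSaturation (P : Submonoid Q) (hP : IsGroupSaturated P) :
    IsGroupSaturated (perfSaturation P) := by
  rw [isGroupSaturated_iff'] at hP ⊢
  rintro q a ⟨n, ha⟩ b ⟨m, hb⟩ h
  refine ⟨n * m, hP _ _ (P.pow_mem ha m) _ (P.pow_mem hb n) ?_⟩
  rw [PNat.mul_coe, ← pow_mul, ← pow_mul, mul_comm (m : ℕ) (n : ℕ), ← mul_pow, h]

variable {P : Submonoid Q}

/-- A homomorphism `ι : P^pf → Q` extending the inclusion `P ⊆ Q` takes the class `a^{1/n}` to an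
`n`-th root of `a`: `ι(a^{1/n})^n = a` (Lemma 3.5 (i), "`P^pf`" portion, p. 75).
[cite: MochizukiEtTh2009, Lem 3.5 p.75] -/
theorem extension_apply_mk_pow (ι : Perfection P →* Q) (hι : ι.comp (Perfection.of P) = P.subtype)
    (a : P) (n : ℕ+) : ι (Perfection.mk a n) ^ (n : ℕ) = (a : Q) := by
  rw [← map_pow, Perfection.mk_pow_self]
  exact DFunLike.congr_fun hι a

/-- **Lemma 3.5 (i)**, "`P^pf`" portion, injectivity (p. 75): every homomorphism `P^pf → Q` extending
the inclusion of a submonoid `P ⊆ Q` is injective ("inclusions `P^pf ↪ Q`"). No hypothesis on `P` or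
`Q` is needed for this clause. [cite: MochizukiEtTh2009, Lem 3.5 p.75] -/
theorem extension_injective (ι : Perfection P →* Q) (hι : ι.comp (Perfection.of P) = P.subtype) :
    Function.Injective ι := by
  intro x y hxy
  obtain ⟨⟨a, n⟩, rfl⟩ := Perfection.mk_surjective x
  obtain ⟨⟨b, m⟩, rfl⟩ := Perfection.mk_surjective y
  dsimp only at hxy ⊢
  refine Perfection.mk_eq_mk_iff.mpr ⟨1, ?_⟩
  rw [PNat.one_coe, one_mul, one_mul]
  apply Subtype.ext
  rw [SubmonoidClass.coe_pow, SubmonoidClass.coe_pow, ← extension_apply_mk_pow ι hι a n,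
    ← extension_apply_mk_pow ι hι b m, ← pow_mul, ← pow_mul, hxy, mul_comm (n : ℕ) (m : ℕ)]

/-- **Lemma 3.5 (i)**, "`P^pf`" portion, uniqueness (p. 75): if `Q` is perfect, two homomorphisms
`P^pf → Q` extending the inclusion `P ⊆ Q` coincide ("extends uniquely").
[cite: MochizukiEtTh2009, Lem 3.5 p.75] -/
theorem extension_unique (hQ : IsPerfect Q) (ι ι' : Perfection P →* Q)
    (hι : ι.comp (Perfection.of P) = P.subtype) (hι' : ι'.comp (Perfection.of P) = P.subtype) :
    ι = ι' := by
  ext x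
  obtain ⟨⟨a, n⟩, rfl⟩ := Perfection.mk_surjective x
  dsimp only
  apply (hQ.bijective_pow n n.pos).1
  dsimp only
  rw [extension_apply_mk_pow ι hι, extension_apply_mk_pow ι' hι']

variable (P)

/-- **Lemma 3.5 (i)**, "`P^pf`" portion, existence (p. 75): if `Q` is perfect, the inclusion of any
submonoid `P ⊆ Q` extends to a homomorphism `P^pf → Q` (namely `P^pf → Q^pf ≅ Q`, `Q → Q^pf` being
bijective for perfect `Q`, [FrdI] §0). [cite: MochizukiEtTh2009, Lem 3.5 p.75] -/
theorem exists_extension (hQ : IsPerfect Q) :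
    ∃ ι : Perfection P →* Q, ι.comp (Perfection.of P) = P.subtype := by
  have hbij : Function.Bijective (Perfection.of Q) := isPerfect_iff_bijective_of.mp hQ
  refine ⟨(MulEquiv.ofBijective (Perfection.of Q) hbij).symm.toMonoidHom.comp
      (Perfection.map P.subtype), ?_⟩
  ext a
  change (MulEquiv.ofBijective (Perfection.of Q) hbij).symm
      (Perfection.map P.subtype (Perfection.of P a)) = (a : Q)
  have h1 : Perfection.map P.subtype (Perfection.of P a) = Perfection.of Q (a : Q) :=
    DFunLike.congr_fun (Perfection.map_comp_of P.subtype) a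
  rw [h1, MulEquiv.symm_apply_eq]
  rfl

/-- **Lemma 3.5 (i)**, "`P^pf`" portion (p. 75): "The inclusion `P ↪ Q` extends uniquely to [an
inclusion] `P^pf ↪ Q`" — for `Q` perfect (the part of "`ℝ` supports `Q`" that is used) and any
submonoid `P`; injectivity is `extension_injective`. [cite: MochizukiEtTh2009, Lem 3.5 p.75] -/
theorem existsUnique_extension (hQ : IsPerfect Q) :
    ∃! ι : Perfection P →* Q, ι.comp (Perfection.of P) = P.subtype := by
  obtain ⟨ι, hι⟩ := exists_extension P hQ
  exact ⟨ι, hι, fun ι' hι' => extension_unique hQ ι' ι hι' hι⟩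

variable {P}

/-- The image of `P^pf ↪ Q` is the perf-saturation `P^pf ∩ Q` of §0 (p. 8): the elements of `Q` some
positive power of which lies in `P` (`Q` perfect). [cite: MochizukiEtTh2009, Lem 3.5 p.75] -/
theorem mrange_extension_eq_perfSaturation (hQ : IsPerfect Q) (ι : Perfection P →* Q)
    (hι : ι.comp (Perfection.of P) = P.subtype) : MonoidHom.mrange ι = perfSaturation P := by
  ext q
  rw [mem_perfSaturation_iff, MonoidHom.mem_mrange]
  constructor
  · rintro ⟨x, rfl⟩
    obtain ⟨⟨a, n⟩, rfl⟩ := Perfection.mk_surjective x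
    refine ⟨n, ?_⟩
    dsimp only
    rw [extension_apply_mk_pow ι hι]
    exact a.2
  · rintro ⟨n, hn⟩
    refine ⟨Perfection.mk ⟨q ^ (n : ℕ), hn⟩ n, (hQ.bijective_pow n n.pos).1 ?_⟩
    dsimp only
    rw [extension_apply_mk_pow ι hι]

/-- **Lemma 3.5 (ii)**, "`P^pf`" portion (p. 75): "Relative to the inclusions of (i), `P^pf` [is]
group-saturated in `Q`" — for `P` group-saturated in the perfect monoid `Q`.
[cite: MochizukiEtTh2009, Lem 3.5 p.75] -/
theorem isGroupSaturated_mrange_extension (hQ : IsPerfect Q) (hP : IsGroupSaturated P)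
    (ι : Perfection P →* Q) (hι : ι.comp (Perfection.of P) = P.subtype) :
    IsGroupSaturated (MonoidHom.mrange ι) := by
  rw [mrange_extension_eq_perfSaturation hQ ι hι]
  exact isGroupSaturated_perfSaturation P hP

end Lemma35

end Literature.AnabelianGeometry.EtaleTheta
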